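import Literature.AnabelianGeometry.AbsoluteAnabelian.AbsAnabLogSpecialFiber
import Literature.IUT.HodgeTheaters.ZHatIntegersInjective
import Literature.IUT.HodgeTheaters.DiscreteProfiniteCompletionsProofs
import HarnessLib

/-!
# [AbsAnab] Lemma 2.5 (i)/(ii): the records `PairingData` and `CyclotomeWithDegree` are inhabited —
# §4(iii) NON-VACUITY witnesses with their Lemma 2.5 predicates PROVED (abc-iut-w5-d197, gen 2)

S. Mochizuki, *The absolute anabelian geometry of hyperbolic curves* (2004) [AbsAnab], Lemma 2.5 p. 29:
(i) the group-theoretic bilinear form `⟨−,−⟩ : (H^{new})^{⊗2} → (M^∨)_ℚ` and its "positive rational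
structure"; (ii) the cyclotome `M = H²(Δ_X, μ_Ẑ(K̄)) ≅ Ẑ` with the degree-`1` class `c₁`.  Typed by
abc-iut-L3 (`AbsAnabLogSpecialFiber.lean`) as the records `PairingData`, `CyclotomeWithDegree` with
the predicates `PairingData.PositiveRationalStructure`, `PreservesDegree`.  Both rows read ZERO
producers in the L4 inhabitation census v3 (07:45Z).  This PROOF-ONLY file (no `def`/`instance`/
`structure`) records:

* `CyclotomeWithDegree.exists_zHat` — the GENUINE ABSTRACT CYCLOTOME: `M := Ẑ` (the additive group
  underlying the profinite completion of `ℤ`; commutative by the tree's `ZHat.mul_comm`), `c₁ :=` the image of `1 ∈ ℤ`, which topologically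
  generates (`ℤ ↪ Ẑ` is dense).  Honest label: the abstract shape `(Ẑ, 1)` of `(H²(Δ_X, μ_Ẑ(K̄)), c₁)` —
  not computed from a curve (no `H²` of profinite groups in the tree); `PreservesDegree` holds at the
  identity (`preservesDegree_refl`).
* `PairingData.exists_rankOne` — the RANK-ONE MODEL `H := ℤ`, `(M^∨)_ℚ := ℚ`, `⟨a, b⟩ := ab`, for which
  Lemma 2.5 (i)'s typed predicate `PositiveRationalStructure` is PROVED (`m = 1`, `⟨a,b⟩ = ab · 1`,
  `⟨a,a⟩ = a² · 1` with `a² > 0` for `a ≠ 0`).  Honest label: a model of the typed predicate (it shows the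
  predicate is satisfiable and correctly oriented), not the form of a curve.

No side taken on [IUTchIII] Cor 3.12; a witness is consistency evidence, not an endorsement; typed ≠ proved.
-/

namespace Literature.AnabelianGeometry.AbsoluteAnabelian

open _root_.Topology
open Literature.IUT.HodgeTheaters (profiniteCompletion toCompletion toCompletion_int_injective ZHat.mul_comm)

/-! ### Lemma 2.5 (ii): the abstract cyclotome `(Ẑ, 1)` -/

/-- **[AbsAnab] Lemma 2.5 (ii) record inhabited — the abstract cyclotome `(Ẑ, 1)`.**  `M := Ẑ`
(additively), `c₁ := 1`, topologically generating since `ℤ` is dense in `Ẑ`; and `c₁ ≠ 0`.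
Honest label: abstract shape of `(H²(Δ_X, μ_Ẑ(K̄)), c₁)`. [cite: MochizukiAbsAnab2004, Lemma 2.5 (ii) p.29] -/
theorem CyclotomeWithDegree.exists_zHat :
    ∃ c : CyclotomeWithDegree.{0},
      c.M = Additive (profiniteCompletion (Multiplicative ℤ)) ∧ c.chernOne ≠ 0 := by
  let Zh : ProfiniteGrp.{0} := profiniteCompletion (Multiplicative ℤ)
  -- `Ẑ` is commutative (abc-iut tree: `ZHat.mul_comm`, by density of `ℤ`); a LOCAL instance only
  letI : CommGroup Zh := { mul_comm := ZHat.mul_comm }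
  let ι : Multiplicative ℤ →* Zh := toCompletion (Multiplicative ℤ)
  let ι' : ℤ →+ Additive Zh := MonoidHom.toAdditiveRight ι
  have hι' : ∀ n : ℤ, ι' n = Additive.ofMul (ι (Multiplicative.ofAdd n)) := fun _ => rfl
  have hd : DenseRange ι := ProfiniteGrp.ProfiniteCompletion.denseRange (GrpCat.of (Multiplicative ℤ))
  have hrange : Set.range ι' = Set.range ι := by
    ext y
    constructor
    · rintro ⟨n, rfl⟩; exact ⟨Multiplicative.ofAdd n, rfl⟩
    · rintro ⟨x, rfl⟩; exact ⟨Multiplicative.toAdd x, rfl⟩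
  have hd' : DenseRange ι' := by
    change Dense (Set.range ι')
    rw [hrange]
    exact hd
  let c₁ : Additive Zh := ι' 1
  -- the range of `ι'` is the subgroup of multiples of `c₁ = ι' 1`
  have hsub : Set.range ι' ⊆ (AddSubgroup.zmultiples c₁ : Set (Additive Zh)) := by
    rintro _ ⟨n, rfl⟩
    refine ⟨n, ?_⟩
    change n • ι' 1 = ι' n
    rw [← map_zsmul, smul_eq_mul, mul_one]
  have hdense : Dense (AddSubgroup.zmultiples c₁ : Set (Additive Zh)) := hd'.mono hsub
  have hne : c₁ ≠ 0 := by
    intro h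
    have h1 : ι (Multiplicative.ofAdd 1) = ι (Multiplicative.ofAdd 0) := by
      change ι' 1 = ι' 0
      rw [map_zero]; exact h
    exact one_ne_zero (Multiplicative.ofAdd.injective (toCompletion_int_injective h1))
  exact ⟨{ M := Additive Zh, chernOne := c₁, dense_zmultiples := hdense }, rfl, hne⟩

/-- `PreservesDegree` holds at the identity of any cyclotome-with-degree (sanity of the predicate's
orientation). [cite: MochizukiAbsAnab2004, Lemma 2.5 (ii) p.29] -/
theorem CyclotomeWithDegree.preservesDegree_refl (c : CyclotomeWithDegree.{0}) :
    PreservesDegree c c (ContinuousAddEquiv.refl c.M) := rfl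

/-- Hence the record is inhabited. [cite: MochizukiAbsAnab2004, Lemma 2.5 (ii) p.29] -/
theorem CyclotomeWithDegree.nonempty : Nonempty CyclotomeWithDegree.{0} := by
  obtain ⟨c, -, -⟩ := CyclotomeWithDegree.exists_zHat
  exact ⟨c⟩

/-! ### Lemma 2.5 (i): the rank-one model `⟨a, b⟩ = ab` -/

/-- **[AbsAnab] Lemma 2.5 (i) record inhabited WITH its positive rational structure.**  `H := ℤ`,
`(M^∨)_ℚ := ℚ`, `⟨a, b⟩ := ab`; `PositiveRationalStructure` holds with `m = 1`.
Honest label: a model of the typed predicate. [cite: MochizukiAbsAnab2004, Lemma 2.5 (i) p.29] -/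
theorem PairingData.exists_rankOne :
    ∃ d : PairingData.{0}, d.H = ℤ ∧ d.MQ = ℚ ∧ d.PositiveRationalStructure := by
  let pair : ℤ →+ ℤ →+ ℚ :=
    AddMonoidHom.mk' (fun a : ℤ => AddMonoidHom.mk' (fun b : ℤ => ((a * b : ℤ) : ℚ))
      (fun b b' => by push_cast; ring))
      (fun a a' => by ext; simp only [AddMonoidHom.mk'_apply, AddMonoidHom.add_apply]; push_cast; ring)
  have hpair : ∀ a b : ℤ, pair a b = ((a * b : ℤ) : ℚ) := fun _ _ => rfl
  refine ⟨{ H := ℤ, MQ := ℚ, pair := pair }, rfl, rfl, ?_⟩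
  refine ⟨(1 : ℚ), one_ne_zero, fun a b => ⟨a * b, ?_⟩, fun a ha => ⟨((a : ℚ)) ^ 2, by positivity, ?_⟩⟩
  · change pair a b = (a * b : ℤ) • (1 : ℚ)
    rw [hpair, zsmul_eq_mul, mul_one]
  · change pair a a = ((a : ℚ) ^ 2) • (1 : ℚ)
    rw [hpair, smul_eq_mul, mul_one]; push_cast; ring

/-- Hence the record is inhabited. [cite: MochizukiAbsAnab2004, Lemma 2.5 (i) p.29] -/
theorem PairingData.nonempty : Nonempty PairingData.{0} := by
  obtain ⟨d, -, -, -⟩ := PairingData.exists_rankOne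
  exact ⟨d⟩

end Literature.AnabelianGeometry.AbsoluteAnabelian
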